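import Mathlib.Analysis.Calculus.ContDiff.Operations
import Mathlib.Analysis.InnerProductSpace.Calculus
import Literature.Analysis.FunctionSpaces.FlatTorus
import Literature.Analysis.FunctionSpaces.TorusCalculus
import Literature.Analysis.FunctionSpaces.TorusCalculusProofs
import HarnessLib

/-!
# Space–time calculus for jointly smooth fields on `S × T^d`

Technical complements to `Torus.IsSmoothSpaceTimeOn` (`TorusCalculus`) and to the
differentiation-under-the-integral results of `TorusCalculusProofs`, needed to pass from
classical to weak formulations of PDEs on the flat torus (Robinson–Rodrigo–Sadowski 2016, §3.1:
"take a classical solution, multiply by a test function and integrate by parts"; every step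
there silently uses that derivatives of jointly smooth fields are jointly smooth and that
space integrals of jointly continuous integrands depend continuously on time):

* closure of `IsSmoothSpaceTimeOn S` under algebra (`add`, `smul`, `inner`, `clm_comp`,
  coordinates) and under **derivatives**: spatial partial derivatives
  (`IsSmoothSpaceTimeOn.partialDeriv`), the one-sided time derivative
  (`IsSmoothSpaceTimeOn.timeDerivWithin`), hence `laplacian`, `gradient`, `divergence`,
  `convect` — on time sets of unique differentiability (`UniqueDiffOn ℝ S`, e.g. intervals with
  nonempty interior), through Mathlib's `ContDiffOn.fderivWithin` applied to the space–time
  lift on `S ×ˢ univ`;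
* uniform-in-space continuity in time (tube lemma over the compact torus,
  `IsSmoothSpaceTimeOn.eventually_norm_sub_lt`) and uniform bounds on compact time sets
  (`IsSmoothSpaceTimeOn.exists_norm_le_of_isCompact`);
* continuity of `t ↦ ∫ u t x dx` on convex `S` (`IsSmoothSpaceTimeOn.continuousOn_integral`).

## References

* J. C. Robinson, J. L. Rodrigo, W. Sadowski, *The Three-Dimensional Navier–Stokes Equations*,
  CUP 2016, §3.1 (from classical to weak solutions). [RobinsonRodrigoSadowski2016]
* L. C. Evans, *Partial Differential Equations*, 2nd ed. (2010), App. C (calculus facts).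
-/

open MeasureTheory Set Topology Filter
open scoped InnerProductSpace ContDiff

noncomputable section

namespace Literature.Analysis.FunctionSpaces

namespace Torus

variable {d : Type*} [Fintype d]
variable {F : Type*} [NormedAddCommGroup F] [NormedSpace ℝ F]
variable {G : Type*} [NormedAddCommGroup G] [NormedSpace ℝ G]

/-! ## Algebraic closure properties -/

section Algebra

variable {S S' : Set ℝ} {u v : ℝ → UnitAddTorus d → F}

/-- Joint smoothness restricts to smaller time sets. [folklore] -/
theorem IsSmoothSpaceTimeOn.mono (hu : IsSmoothSpaceTimeOn S u) (h : S' ⊆ S) :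
    IsSmoothSpaceTimeOn S' u :=
  ContDiffOn.mono hu (prod_mono h subset_rfl)

/-- A field whose space–time lift is smooth on all of `ℝ × ℝ^d` is jointly smooth on every
time set. [folklore] -/
theorem isSmoothSpaceTimeOn_of_contDiff {ψ : ℝ → UnitAddTorus d → F}
    (hψ : ContDiff ℝ ∞ (stLift ψ)) (S : Set ℝ) : IsSmoothSpaceTimeOn S ψ :=
  hψ.contDiffOn

/-- Time-independent smooth fields are jointly smooth. [folklore] -/
theorem isSmoothSpaceTimeOn_const {g : UnitAddTorus d → F} (hg : IsSmooth g)
    (S : Set ℝ) : IsSmoothSpaceTimeOn S (fun _ : ℝ => g) := by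
  have h : stLift (fun _ : ℝ => g) = lift g ∘ Prod.snd := by
    funext z; rfl
  unfold IsSmoothSpaceTimeOn
  rw [h]
  exact (hg.comp contDiff_snd).contDiffOn

/-- Sums of jointly smooth fields are jointly smooth. [folklore] -/
theorem IsSmoothSpaceTimeOn.add (hu : IsSmoothSpaceTimeOn S u) (hv : IsSmoothSpaceTimeOn S v) :
    IsSmoothSpaceTimeOn S (fun t x => u t x + v t x) :=
  ContDiffOn.add hu hv

/-- Differences of jointly smooth fields are jointly smooth. [folklore] -/
theorem IsSmoothSpaceTimeOn.sub (hu : IsSmoothSpaceTimeOn S u) (hv : IsSmoothSpaceTimeOn S v) :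
    IsSmoothSpaceTimeOn S (fun t x => u t x - v t x) :=
  ContDiffOn.sub hu hv

/-- Negatives of jointly smooth fields are jointly smooth. [folklore] -/
theorem IsSmoothSpaceTimeOn.neg (hu : IsSmoothSpaceTimeOn S u) :
    IsSmoothSpaceTimeOn S (fun t x => -u t x) :=
  ContDiffOn.neg hu

/-- Constant multiples of jointly smooth fields are jointly smooth. [folklore] -/
theorem IsSmoothSpaceTimeOn.const_smul (hu : IsSmoothSpaceTimeOn S u) (c : ℝ) :
    IsSmoothSpaceTimeOn S (fun t x => c • u t x) :=
  ContDiffOn.const_smul c hu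

/-- Products of a jointly smooth scalar and a jointly smooth vector field are jointly smooth. [folklore] -/
theorem IsSmoothSpaceTimeOn.smul {θ : ℝ → UnitAddTorus d → ℝ} (hθ : IsSmoothSpaceTimeOn S θ)
    (hu : IsSmoothSpaceTimeOn S u) : IsSmoothSpaceTimeOn S (fun t x => θ t x • u t x) :=
  ContDiffOn.smul hθ hu

/-- Products of jointly smooth scalar fields are jointly smooth. [folklore] -/
theorem IsSmoothSpaceTimeOn.mul {θ φ : ℝ → UnitAddTorus d → ℝ} (hθ : IsSmoothSpaceTimeOn S θ)
    (hφ : IsSmoothSpaceTimeOn S φ) : IsSmoothSpaceTimeOn S (fun t x => θ t x * φ t x) :=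
  ContDiffOn.mul hθ hφ

/-- Inner products of jointly smooth fields are jointly smooth. [folklore] -/
theorem IsSmoothSpaceTimeOn.inner {E : Type*} [NormedAddCommGroup E] [InnerProductSpace ℝ E]
    {a b : ℝ → UnitAddTorus d → E} (ha : IsSmoothSpaceTimeOn S a) (hb : IsSmoothSpaceTimeOn S b) :
    IsSmoothSpaceTimeOn S (fun t x => ⟪a t x, b t x⟫_ℝ) :=
  ContDiffOn.inner ℝ ha hb

/-- Post-composition with a continuous linear map preserves joint smoothness. [folklore] -/
theorem IsSmoothSpaceTimeOn.clm_comp (hu : IsSmoothSpaceTimeOn S u) (L : F →L[ℝ] G) :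
    IsSmoothSpaceTimeOn S (fun t x => L (u t x)) :=
  L.contDiff.comp_contDiffOn hu

/-- Coordinates of a jointly smooth vector field are jointly smooth. [folklore] -/
theorem IsSmoothSpaceTimeOn.apply {w : ℝ → UnitAddTorus d → EuclideanSpace ℝ d}
    (hw : IsSmoothSpaceTimeOn S w) (i : d) : IsSmoothSpaceTimeOn S (fun t x => w t x i) :=
  hw.clm_comp (EuclideanSpace.proj i)

/-- Finite sums of jointly smooth fields are jointly smooth. [folklore] -/
theorem IsSmoothSpaceTimeOn.sum {ι : Type*} {s : Finset ι} {w : ι → ℝ → UnitAddTorus d → F}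
    (hw : ∀ i ∈ s, IsSmoothSpaceTimeOn S (w i)) :
    IsSmoothSpaceTimeOn S (fun t x => ∑ i ∈ s, w i t x) := by
  have h : stLift (fun t x => ∑ i ∈ s, w i t x) = fun z => ∑ i ∈ s, stLift (w i) z := by
    funext z; rfl
  unfold IsSmoothSpaceTimeOn
  rw [h]
  exact ContDiffOn.sum hw

end Algebra

/-! ## Continuity: tube lemma and uniform bounds -/

section Continuity

variable {S : Set ℝ} {u : ℝ → UnitAddTorus d → F}

/-- The space–time lift of a jointly smooth field is continuous on `S × ℝ^d`. [folklore] -/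
theorem IsSmoothSpaceTimeOn.continuousOn_stLift (hu : IsSmoothSpaceTimeOn S u) :
    ContinuousOn (stLift u) (S ×ˢ univ) :=
  ContDiffOn.continuousOn hu

omit [Fintype d] [NormedSpace ℝ F] in
/-- **Tube lemma over the compact torus.** For a field with space–time lift continuous on
`S × ℝ^d`, `u s → u t` uniformly on `T^d` as `s → t` within `S`:
for every `ε > 0`, eventually `‖u s x - u t x‖ < ε` for all `x`. [folklore] -/
theorem eventually_norm_sub_lt_of_continuousOn (hu : ContinuousOn (stLift u) (S ×ˢ univ)) {t : ℝ}
    (ht : t ∈ S) {ε : ℝ} (hε : 0 < ε) : ∀ᶠ s in 𝓝[S] t, ∀ x, ‖u s x - u t x‖ < ε := by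
  set Gu : ℝ × EuclideanSpace ℝ d → F := stLift u with hGu
  have htube : ∀ᶠ s in 𝓝 t, ∀ y ∈ ((WithLp.toLp 2) '' (Set.pi univ fun _ : d => Icc (0 : ℝ) 1) :
      Set (EuclideanSpace ℝ d)), s ∈ S → ‖Gu (s, y) - Gu (t, y)‖ < ε := by
    apply isCompact_toLp_image_pi_Icc.eventually_forall_of_forall_eventually
    intro y _
    have hε2 : 0 < ε / 2 := half_pos hε
    have h : ∀ᶠ z in 𝓝[S ×ˢ univ] (t, y), dist (Gu z) (Gu (t, y)) < ε / 2 :=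
      Metric.tendsto_nhds.1 (hu (t, y) (mk_mem_prod ht (mem_univ y))) _ hε2
    rw [eventually_nhdsWithin_iff] at h
    have h2 : Tendsto (fun z : ℝ × EuclideanSpace ℝ d => ((t, z.2) : ℝ × EuclideanSpace ℝ d))
        (𝓝 (t, y)) (𝓝[S ×ˢ univ] (t, y)) := by
      refine tendsto_nhdsWithin_iff.2 ⟨?_, Eventually.of_forall fun z => mk_mem_prod ht (mem_univ _)⟩
      exact ((continuous_const.prodMk continuous_snd).tendsto' (t, y) (t, y) rfl)
    have h' : ∀ᶠ z in 𝓝 (t, y), dist (Gu (t, z.2)) (Gu (t, y)) < ε / 2 :=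
      Metric.tendsto_nhds.1 ((hu (t, y) (mk_mem_prod ht (mem_univ y))).tendsto.comp h2) _ hε2
    filter_upwards [h, h'] with z hz hz' hzS
    rw [← dist_eq_norm]
    calc dist (Gu (z.1, z.2)) (Gu (t, z.2))
        ≤ dist (Gu z) (Gu (t, y)) + dist (Gu (t, z.2)) (Gu (t, y)) := dist_triangle_right _ _ _
      _ < ε / 2 + ε / 2 := add_lt_add (hz (mk_mem_prod hzS (mem_univ _))) hz'
      _ = ε := add_halves ε
  rw [eventually_nhdsWithin_iff]
  filter_upwards [htube] with s hs hsS x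
  have h1 := hs (repr x) (repr_mem_toLp_image_pi_Icc x) hsS
  simpa [hGu] using h1

/-- Uniform-in-space continuity in time of a jointly smooth field (tube lemma). [folklore] -/
theorem IsSmoothSpaceTimeOn.eventually_norm_sub_lt (hu : IsSmoothSpaceTimeOn S u) {t : ℝ}
    (ht : t ∈ S) {ε : ℝ} (hε : 0 < ε) : ∀ᶠ s in 𝓝[S] t, ∀ x, ‖u s x - u t x‖ < ε :=
  eventually_norm_sub_lt_of_continuousOn hu.continuousOn_stLift ht hε

omit [Fintype d] [NormedSpace ℝ F] in
/-- **Uniform bound on compact time sets.** A field with space–time lift continuous on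
`S × ℝ^d` is bounded on `K × T^d` for every compact `K ⊆ S`. [folklore] -/
theorem exists_norm_le_of_continuousOn_of_isCompact (hu : ContinuousOn (stLift u) (S ×ˢ univ))
    {K : Set ℝ} (hK : IsCompact K) (hKS : K ⊆ S) : ∃ C : ℝ, ∀ t ∈ K, ∀ x, ‖u t x‖ ≤ C := by
  have hc : ContinuousOn (stLift u)
      (K ×ˢ ((WithLp.toLp 2) '' (Set.pi univ fun _ : d => Icc (0 : ℝ) 1))) :=
    hu.mono (prod_mono hKS (subset_univ _))
  obtain ⟨C, hC⟩ := (hK.prod isCompact_toLp_image_pi_Icc).exists_bound_of_continuousOn hc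
  refine ⟨C, fun t ht x => ?_⟩
  have h := hC (t, repr x) (mk_mem_prod ht (repr_mem_toLp_image_pi_Icc x))
  simpa using h

/-- A jointly smooth field is bounded on `K × T^d` for every compact `K ⊆ S`. [folklore] -/
theorem IsSmoothSpaceTimeOn.exists_norm_le_of_isCompact (hu : IsSmoothSpaceTimeOn S u)
    {K : Set ℝ} (hK : IsCompact K) (hKS : K ⊆ S) : ∃ C : ℝ, ∀ t ∈ K, ∀ x, ‖u t x‖ ≤ C :=
  exists_norm_le_of_continuousOn_of_isCompact hu.continuousOn_stLift hK hKS

/-- Space integrals of a jointly smooth field depend continuously on time (within a convex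
time set; from `IsSmoothSpaceTimeOn.hasDerivWithinAt_integral`). [folklore] -/
theorem IsSmoothSpaceTimeOn.continuousOn_integral (hu : IsSmoothSpaceTimeOn S u) (hS : Convex ℝ S) :
    ContinuousOn (fun t => ∫ x, u t x) S :=
  fun _ ht => (hu.hasDerivWithinAt_integral hS ht).continuousWithinAt

/-- The space–time lift restricted to `S × ℝ^d` is a.e. strongly measurable for the product
measure restricted to `S' × ℝ^d`, `S' ⊆ S` measurable. [folklore] -/
theorem IsSmoothSpaceTimeOn.aestronglyMeasurable_stLift (hu : IsSmoothSpaceTimeOn S u) {S' : Set ℝ}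
    (hS' : MeasurableSet S') (h : S' ⊆ S) :
    AEStronglyMeasurable (stLift u) (volume.restrict (S' ×ˢ (univ : Set (EuclideanSpace ℝ d)))) :=
  (hu.continuousOn_stLift.mono (prod_mono h subset_rfl)).aestronglyMeasurable
    (hS'.prod MeasurableSet.univ)

end Continuity

/-! ## Derivatives of jointly smooth fields are jointly smooth -/

section Derivatives

variable {S : Set ℝ} {u : ℝ → UnitAddTorus d → F}

/-- Spatial Fréchet derivatives of the slices through the space–time lift:
`D(u t)(proj y) w = D_{S × ℝ^d}(stLift u)(t, y) (0, w)` for `t ∈ S`. [folklore] -/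
theorem IsSmoothSpaceTimeOn.fderiv_slice_apply (hu : IsSmoothSpaceTimeOn S u) {t : ℝ} (ht : t ∈ S)
    (y w : EuclideanSpace ℝ d) :
    Torus.fderiv (u t) (proj y) w = fderivWithin ℝ (stLift u) (S ×ˢ univ) (t, y) (0, w) := by
  have h1 : HasFDerivWithinAt (stLift u) (fderivWithin ℝ (stLift u) (S ×ˢ univ) (t, y))
      (S ×ˢ univ) (t, y) :=
    (hu.differentiableOn (by simp) (t, y) (mk_mem_prod ht (mem_univ _))).hasFDerivWithinAt
  have h2 : HasFDerivAt (fun z : EuclideanSpace ℝ d => ((t, z) : ℝ × EuclideanSpace ℝ d))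
      (ContinuousLinearMap.inr ℝ ℝ (EuclideanSpace ℝ d)) y := hasFDerivAt_prodMk_right t y
  have h3 := h1.comp_hasFDerivAt y h2 (Eventually.of_forall fun z => mk_mem_prod ht (mem_univ _))
  rw [← fderiv_lift]
  have hcomp : (stLift u ∘ fun z : EuclideanSpace ℝ d => ((t, z) : ℝ × EuclideanSpace ℝ d)) =
      lift (u t) := by
    funext z; rfl
  rw [hcomp] at h3
  rw [h3.fderiv]
  rfl

/-- **Directional spatial derivatives of jointly smooth fields are jointly smooth** (on time
sets of unique differentiability): the lift of `(t, x) ↦ ∂ᵥ(u t)(x)` is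
`z ↦ D_{S × ℝ^d}(stLift u)(z) (0, v)` on `S × ℝ^d` (Mathlib `ContDiffOn.fderivWithin`). [folklore] -/
theorem IsSmoothSpaceTimeOn.lineDeriv (hu : IsSmoothSpaceTimeOn S u) (hS : UniqueDiffOn ℝ S)
    (v : EuclideanSpace ℝ d) : IsSmoothSpaceTimeOn S (fun t x => Torus.lineDeriv (u t) x v) := by
  have hU : UniqueDiffOn ℝ (S ×ˢ (univ : Set (EuclideanSpace ℝ d))) := hS.prod uniqueDiffOn_univ
  have hG : ContDiffOn ℝ ∞ (fun z => fderivWithin ℝ (stLift u) (S ×ˢ univ) z (0, v))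
      (S ×ˢ (univ : Set (EuclideanSpace ℝ d))) :=
    (hu.fderivWithin hU le_rfl).clm_apply contDiffOn_const
  refine hG.congr fun z hz => ?_
  obtain ⟨t, y⟩ := z
  have ht : t ∈ S := (mem_prod.1 hz).1
  rw [stLift_apply, lineDeriv_eq_fderiv_apply ((hu.isSmooth_slice ht).isContDiff (by simp)),
    hu.fderiv_slice_apply ht]

variable [DecidableEq d]

/-- Spatial partial derivatives of jointly smooth fields are jointly smooth (on time sets of
unique differentiability). [folklore] -/
theorem IsSmoothSpaceTimeOn.partialDeriv (hu : IsSmoothSpaceTimeOn S u) (hS : UniqueDiffOn ℝ S)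
    (i : d) : IsSmoothSpaceTimeOn S (fun t => Torus.partialDeriv i (u t)) :=
  hu.lineDeriv hS (EuclideanSpace.single i 1)

omit [DecidableEq d] in
/-- The one-sided time derivative of a jointly smooth field is jointly smooth (on time sets of
unique differentiability): its lift is `z ↦ D_{S × ℝ^d}(stLift u)(z) (1, 0)` on `S × ℝ^d`
(`IsSmoothSpaceTimeOn.timeDerivWithin_apply_proj`). [folklore] -/
theorem IsSmoothSpaceTimeOn.timeDerivWithin (hu : IsSmoothSpaceTimeOn S u) (hS : UniqueDiffOn ℝ S) :
    IsSmoothSpaceTimeOn S (Torus.timeDerivWithin S u) := by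
  have hU : UniqueDiffOn ℝ (S ×ˢ (univ : Set (EuclideanSpace ℝ d))) := hS.prod uniqueDiffOn_univ
  have hG : ContDiffOn ℝ ∞ (fun z => fderivWithin ℝ (stLift u) (S ×ˢ univ) z (1, 0))
      (S ×ˢ (univ : Set (EuclideanSpace ℝ d))) :=
    (hu.fderivWithin hU le_rfl).clm_apply contDiffOn_const
  refine hG.congr fun z hz => ?_
  obtain ⟨t, y⟩ := z
  exact hu.timeDerivWithin_apply_proj hS (mem_prod.1 hz).1 y

/-- Laplacians of jointly smooth fields are jointly smooth (on time sets of unique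
differentiability; `Δ = ∑ᵢ ∂ᵢ∂ᵢ` slice-wise). [folklore] -/
theorem IsSmoothSpaceTimeOn.laplacian (hu : IsSmoothSpaceTimeOn S u) (hS : UniqueDiffOn ℝ S) :
    IsSmoothSpaceTimeOn S (fun t => Torus.laplacian (u t)) := by
  have h : IsSmoothSpaceTimeOn S
      (fun t x => ∑ i, Torus.partialDeriv i (Torus.partialDeriv i (u t)) x) :=
    IsSmoothSpaceTimeOn.sum fun i _ => (hu.partialDeriv hS i).partialDeriv hS i
  refine ContDiffOn.congr h fun z hz => ?_
  obtain ⟨t, y⟩ := z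
  exact laplacian_eq_sum_partialDeriv_partialDeriv (hu.isSmooth_slice (mem_prod.1 hz).1) _

/-- Convective derivatives `(w·∇)u` of jointly smooth fields are jointly smooth (on time sets of
unique differentiability; `D(u t)(x)[w] = ∑ᵢ wᵢ ∂ᵢ(u t)(x)`). [folklore] -/
theorem IsSmoothSpaceTimeOn.convect {w : ℝ → UnitAddTorus d → EuclideanSpace ℝ d}
    (hw : IsSmoothSpaceTimeOn S w) (hu : IsSmoothSpaceTimeOn S u) (hS : UniqueDiffOn ℝ S) :
    IsSmoothSpaceTimeOn S (fun t => Torus.convect (w t) (u t)) := by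
  have h : IsSmoothSpaceTimeOn S (fun t x => ∑ i, w t x i • Torus.partialDeriv i (u t) x) :=
    IsSmoothSpaceTimeOn.sum fun i _ => (hw.apply i).smul (hu.partialDeriv hS i)
  refine ContDiffOn.congr h fun z hz => ?_
  obtain ⟨t, y⟩ := z
  exact fderiv_apply_eq_sum_partialDeriv ((hu.isSmooth_slice (mem_prod.1 hz).1).isContDiff (by simp))
    _ _

/-- The gradient in coordinates: `∇θ(x) = ∑ᵢ ∂ᵢθ(x) eᵢ` for `C¹` scalar `θ`. [folklore] -/
theorem gradient_eq_sum_partialDeriv {θ : UnitAddTorus d → ℝ} (hθ : IsContDiff 1 θ)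
    (x : UnitAddTorus d) :
    Torus.gradient θ x = ∑ i, Torus.partialDeriv i θ x • EuclideanSpace.single i (1 : ℝ) := by
  refine ext_inner_right ℝ fun w => ?_
  rw [inner_gradient_left, fderiv_apply_eq_sum_partialDeriv hθ, sum_inner]
  refine Finset.sum_congr rfl fun i _ => ?_
  rw [real_inner_smul_left, EuclideanSpace.inner_single_left]
  simp [mul_comm]

/-- Gradients of jointly smooth scalar fields are jointly smooth (on time sets of unique
differentiability). [folklore] -/
theorem IsSmoothSpaceTimeOn.gradient {p : ℝ → UnitAddTorus d → ℝ} (hp : IsSmoothSpaceTimeOn S p)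
    (hS : UniqueDiffOn ℝ S) : IsSmoothSpaceTimeOn S (fun t => Torus.gradient (p t)) := by
  have h : IsSmoothSpaceTimeOn S
      (fun t x => ∑ i, Torus.partialDeriv i (p t) x • EuclideanSpace.single i (1 : ℝ)) :=
    IsSmoothSpaceTimeOn.sum fun i _ =>
      (hp.partialDeriv hS i).smul (isSmoothSpaceTimeOn_const (isSmooth_const _) S)
  refine ContDiffOn.congr h fun z hz => ?_
  obtain ⟨t, y⟩ := z
  exact gradient_eq_sum_partialDeriv ((hp.isSmooth_slice (mem_prod.1 hz).1).isContDiff (by simp)) _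

/-- Divergences of jointly smooth vector fields are jointly smooth (on time sets of unique
differentiability). [folklore] -/
theorem IsSmoothSpaceTimeOn.divergence {w : ℝ → UnitAddTorus d → EuclideanSpace ℝ d}
    (hw : IsSmoothSpaceTimeOn S w) (hS : UniqueDiffOn ℝ S) :
    IsSmoothSpaceTimeOn S (fun t => Torus.divergence (w t)) :=
  IsSmoothSpaceTimeOn.sum fun i _ => (hw.apply i).partialDeriv hS i

omit [DecidableEq d] in
/-- Leibniz rule for the one-sided time derivative of an inner product of jointly smooth
fields (on time sets of unique differentiability). [folklore] -/
theorem IsSmoothSpaceTimeOn.timeDerivWithin_inner {E : Type*} [NormedAddCommGroup E]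
    [InnerProductSpace ℝ E] {a b : ℝ → UnitAddTorus d → E} (ha : IsSmoothSpaceTimeOn S a)
    (hb : IsSmoothSpaceTimeOn S b) (hS : UniqueDiffOn ℝ S) {t : ℝ} (ht : t ∈ S) (x : UnitAddTorus d) :
    Torus.timeDerivWithin S (fun s y => ⟪a s y, b s y⟫_ℝ) t x =
      ⟪a t x, Torus.timeDerivWithin S b t x⟫_ℝ + ⟪Torus.timeDerivWithin S a t x, b t x⟫_ℝ :=
  ((ha.hasDerivWithinAt_slice ht x).inner ℝ (hb.hasDerivWithinAt_slice ht x)).derivWithin (hS t ht)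

omit [DecidableEq d] in
/-- For a field smooth on all of `ℝ × ℝ^d` (e.g. a test field), the one-sided time derivative
within a set of unique differentiability is the two-sided one. [folklore] -/
theorem timeDerivWithin_eq_timeDeriv_of_contDiff {ψ : ℝ → UnitAddTorus d → F}
    (hψ : ContDiff ℝ ∞ (stLift ψ)) (hS : UniqueDiffOn ℝ S) {t : ℝ} (ht : t ∈ S)
    (x : UnitAddTorus d) : Torus.timeDerivWithin S ψ t x = Torus.timeDeriv ψ t x := by
  obtain ⟨y, rfl⟩ := proj_surjective x
  have hd : DifferentiableAt ℝ (fun τ : ℝ => ψ τ (proj y)) t := by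
    have h : (fun τ : ℝ => ψ τ (proj y)) = stLift ψ ∘ fun τ : ℝ => (τ, y) := by
      funext τ; rfl
    rw [h]
    exact ((hψ.differentiable (by simp)).differentiableAt).comp t
      (differentiableAt_id.prodMk (differentiableAt_const _))
  exact hd.derivWithin (hS t ht)

end Derivatives

end Torus

end Literature.Analysis.FunctionSpaces
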